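import Summits.FinalStateConjecture.FinalStateConjecture.Theorems.EIHFluxBalanceInertialRecessionStubChargeModelSpheres
import Summits.FinalStateConjecture.FinalStateConjecture.Theorems.EIHFluxBalanceInertialRecessionStubChargeModelMollify
import Summits.FinalStateConjecture.FinalStateConjecture.Theorems.EIHFluxBalanceInertialRecessionStubChargeModelWindowLawPrep

/-!
# Route EIHFluxBalance — `InertialRecession`, line `sublinear-is-free-clean-window-charges`:
# the WINDOW LAW half of `stub_chargeModel`, from the moving-sphere law

Helper file (`--supports stmt-FinalStateConjecture-10166`). `windowLaw_of_windowCharges`: granted the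
finite-horizon moving-sphere law WCH′ (the statement of `stub_windowCharges`, as hypothesis), the crux
antecedent with `0 < N`, slaving and quasi-stationarity give the WINDOW LAW of the line for the lab metric.
The window path is shadowed by a `C¹` path of the same speed pinned at `c(t₁)` (time `t₁`) and `c(t₂)`
(time `t₂ + η`) (`exists_contDiff_shadow_of_lipschitzOn`); WCH′ is applied to it on `[t₁, t₂ + η]` and to
the static sphere `(c(t₂), R(t₂))` on `[t₂, t₂ + η]`, inside the region of `labRegion_props` with the sphere
bound `b(s) = K (δ/4)^{-7/4} R̂(s)^{-7/4}` of `sphereConditions`; `η = min (1/12) (∫ R^{-3/2})` absorbs the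
two `O(η)` terms. `eventually_norm_deriv_centre_le_two`: slaved centres move at lab speed `≤ 2`.
-/


set_option linter.dupNamespace false
-- instance search on the nested operator spaces needs a deeper pending depth (as in `CoordCurvature.lean`)
set_option maxSynthPendingDepth 3

noncomputable section

open scoped Manifold ContDiff Topology BigOperators ENNReal
open Filter Set Function TopologicalSpace MeasureTheory Literature.Geometry.Lorentzian

namespace Summit.FinalStateConjecture.FinalStateConjecture.Theorems

namespace SublinearIsFree.ChargeModel

/-- **Slaved painted centres move at lab speed `≤ 2` at late times**: if `ξ̇ − v(Λ) → 0` with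
`v(Λ) = (Λe₀)~/(Λe₀)⁰` (so `‖v(Λ)‖ ≤ 1`), then eventually `‖ξ̇‖ ≤ 2`. [folklore] -/
theorem eventually_norm_deriv_centre_le_two (Λ : ℝ → lorentzGroup) (ξ : ℝ → E3)
    (h : Tendsto (fun t ↦ deriv ξ t - ((((Λ t : lorentzGroup) : E4 ≃L[ℝ] E4) (E4.basisVector 0)) 0)⁻¹ •
      E4.spatial (((Λ t : lorentzGroup) : E4 ≃L[ℝ] E4) (E4.basisVector 0))) atTop (𝓝 0)) :
    ∀ᶠ t in atTop, ‖deriv ξ t‖ ≤ 2 := by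
  have h1 := tendsto_iff_norm_sub_tendsto_zero.1 h
  have h2 : ∀ᶠ t in atTop, ‖(deriv ξ t - ((((Λ t : lorentzGroup) : E4 ≃L[ℝ] E4) (E4.basisVector 0)) 0)⁻¹ •
      E4.spatial (((Λ t : lorentzGroup) : E4 ≃L[ℝ] E4) (E4.basisVector 0))) - 0‖ < 1 :=
    (tendsto_order.1 h1).2 1 one_pos
  filter_upwards [h2] with t ht
  rw [sub_zero] at ht
  have hv : ‖((((Λ t : lorentzGroup) : E4 ≃L[ℝ] E4) (E4.basisVector 0)) 0)⁻¹ •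
      E4.spatial (((Λ t : lorentzGroup) : E4 ≃L[ℝ] E4) (E4.basisVector 0))‖ ≤ 1 := by
    rw [norm_smul, norm_inv, Real.norm_eq_abs]
    have hsq := lorentz_apply_zero_sq (Λ t)
    have hpos : 0 < |(((Λ t : lorentzGroup) : E4 ≃L[ℝ] E4) (E4.basisVector 0)) 0| :=
      one_pos.trans_le (one_le_abs_lorentz_apply_zero (Λ t))
    rw [inv_mul_le_iff₀ hpos, mul_one]
    refine (sq_le_sq₀ (E4.spatialNorm_nonneg _) (abs_nonneg _)).1 ?_
    rw [sq_abs]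
    nlinarith [hsq]
  calc ‖deriv ξ t‖ ≤ ‖deriv ξ t - ((((Λ t : lorentzGroup) : E4 ≃L[ℝ] E4) (E4.basisVector 0)) 0)⁻¹ •
        E4.spatial (((Λ t : lorentzGroup) : E4 ≃L[ℝ] E4) (E4.basisVector 0))‖ +
        ‖((((Λ t : lorentzGroup) : E4 ≃L[ℝ] E4) (E4.basisVector 0)) 0)⁻¹ •
        E4.spatial (((Λ t : lorentzGroup) : E4 ≃L[ℝ] E4) (E4.basisVector 0))‖ := norm_le_norm_sub_add _ _
    _ ≤ 2 := by linarith [ht.le]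

-- the algebraic and the operator-norm instance paths on `E4 →L[ℝ] E4 →L[ℝ] ℝ` unify slowly
set_option synthInstance.maxHeartbeats 400000 in
set_option maxHeartbeats 6400000 in
/-- **The WINDOW LAW of the lab metric from the moving-sphere law** (see the module docstring).
[cite: LandauLifshitz1975, §96 (96.16)] -/
theorem windowLaw_of_windowCharges :
    (∃ C : ℝ, ∀ (g : E4 → E4 →L[ℝ] E4 →L[ℝ] ℝ) (W : Set E4) (c : ℝ → E3) (R b : ℝ → ℝ) (t₁ t₂ : ℝ), IsOpen W → ContDiffOn ℝ (⊤ : ℕ∞) g W → (∀ x ∈ W, ∀ v w : E4, g x v w = g x w v) → (∀ x ∈ W, MetricCoord.ricAt g x = 0) → 0 < t₁ → t₁ ≤ t₂ → ContDiff ℝ 1 c → ContDiff ℝ 1 R → ContinuousOn b (Set.Icc t₁ t₂) → (∀ t ∈ Set.Icc t₁ t₂, ‖deriv c t‖ ≤ 2 ∧ |deriv R t| ≤ 2 ∧ 1 ≤ R t) → (∀ t ∈ Set.Icc t₁ t₂, ∀ y ∈ Metric.sphere (c t) (R t), E4.ofTimeSpace t y ∈ W ∧ ‖g (E4.ofTimeSpace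 t y) - Minkowski.bilin‖ ≤ 1 / 2 ∧ ∀ v : E4, ‖fderiv ℝ g (E4.ofTimeSpace t y) v‖ ≤ b t * ‖v‖) → ∀ μ : Fin 4, |LandauLifshitz.quasiLocalMomentum g t₂ (c t₂) (R t₂) μ - LandauLifshitz.quasiLocalMomentum g t₁ (c t₁) (R t₁) μ| ≤ C * ∫ s in t₁..t₂, R s ^ 2 * b s ^ 2) →
    ∀ (X : Type) [TopologicalSpace X] [ChartedSpace E3 X] [IsManifold (𝓡 3) ((⊤ : ℕ∞) : WithTop ℕ∞) X] [T2Space X] [SecondCountableTopology X] [ConnectedSpace X], ∀ D ∈ admissibleVacuumData X, ∀ 𝒟 : VacuumCauchyDevelopment D, 𝒟.IsMaximal → ∀ (N : ℕ) (M a rin : Fin N → ℝ) (Λ : Fin N → ℝ → lorentzGroup) (ξ : Fin N → ℝ → E3) (γ κ τ₀ : ℝ) (U : Opens E4) (Φ : U → 𝒟.carrier) (O : Set 𝒟.carrier), ((∀ i, Kerr.IsSubextremal (M i) (a i) ∧ Kerr.rMinus (M i) (a i) < rin i ∧ rin i < Kerr.rPlus (M i) (a i)) ∧ (∀ i t, |((Λ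 i t : E4 ≃L[ℝ] E4) (E4.basisVector 0)) 0| ≤ γ) ∧ (∀ i, ContDiff ℝ ((⊤ : ℕ∞) : WithTop ℕ∞) (ξ i) ∧ ContDiff ℝ ((⊤ : ℕ∞) : WithTop ℕ∞) (fun t ↦ ((Λ i t : E4 ≃L[ℝ] E4) : E4 →L[ℝ] E4))) ∧ (∀ i j, i ≠ j → Tendsto (fun t ↦ ‖ξ i t - ξ j t‖) atTop atTop) ∧ (0 < κ ∧ κ < 1 ∧ ∀ i, ∀ᶠ t in atTop, ‖ξ i t‖ ≤ κ ^ 2 * t) ∧ ({x : E4 | τ₀ < x 0 ∧ ∀ i, rin i < Kerr.radius (a i) (poincareInv (Λ i (x 0)) (E4.ofTimeSpace (x 0) (ξ i (x 0))) x)} ⊆ (U : Set E4)) ∧ let B : ModelBackground := ⟨U, fun x ↦ Minkowski.bilin + ∑ i, (boostedKerrBilin (Λ i (x 0)) (E4.ofTimeSpace (x 0) (ξ i (x 0))) (M i) (a i) x - Minkowski.bilin), fun x ↦ x 0, E4.spatialNorm⟩; ContMDiff 𝓘(ℝ, E4) (𝓡 4) ((⊤ : ℕ∞) : WithTop ℕ∞)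 Φ ∧ Topology.IsOpenEmbedding ((B.lateRegion τ₀).restrict Φ) ∧ Φ '' {x : U | τ₀ < x.1 0 ∧ ∀ i, Kerr.rPlus (M i) (a i) < Kerr.radius (a i) (poincareInv (Λ i (x.1 0)) (E4.ofTimeSpace (x.1 0) (ξ i (x.1 0))) x.1)} ⊆ O ∧ Tendsto (fun t ↦ 𝒟.toSpacetime.deviationCk B Φ 3 t) atTop (𝓝 0) ∧ Tendsto (fun t : ℝ ↦ ⨆ x ∈ {x : U | x.1 0 = t ∧ E4.spatialNorm x.1 ≤ κ * t}, ⨆ (m : ℕ) (_ : m ≤ 3), ENNReal.ofReal (1 + √(√((⨅ i, ‖E4.spatial x.1 - ξ i t‖) ^ 7))) * ‖iteratedFDeriv ℝ m (𝒟.toSpacetime.deviationExtend B Φ) x.1‖ₑ) atTop (𝓝 0) ∧ O = Summit.FinalStateConjecture.exteriorOf 𝒟.toCauchyDevelopment (Φ '' {x : U | τ₀ < x.1 0 ∧ ∀ i, Kerr.rPlus (M i) (a i) < Kerr.radius (a i) (poincareInv (Λ i (x.1 0)) (E4.ofTimeSpace (x.1 0) (ξ i (x.1 0))) x.1)}) ∧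 ∀ t₁ : ℝ, τ₀ < t₁ → O \ Φ '' {x : U | t₁ < x.1 0 ∧ ∀ i, Kerr.rPlus (M i) (a i) < Kerr.radius (a i) (poincareInv (Λ i (x.1 0)) (E4.ofTimeSpace (x.1 0) (ξ i (x.1 0))) x.1)} ⊆ 𝒟.metric.causalPast 𝒟.timeOrientation (Φ '' {x : U | x.1 0 = t₁ ∧ ∀ i, Kerr.rPlus (M i) (a i) < Kerr.radius (a i) (poincareInv (Λ i (x.1 0)) (E4.ofTimeSpace (x.1 0) (ξ i (x.1 0))) x.1)})) → 0 < N →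
    (∀ i : Fin N, (∀ m : ℕ, 1 ≤ m → m ≤ 3 → Tendsto (fun t ↦ iteratedDeriv m (fun s ↦ (((Λ i s : lorentzGroup) : E4 ≃L[ℝ] E4) (E4.basisVector 0))) t) atTop (𝓝 0)) ∧ (∀ m : ℕ, m ≤ 2 → Tendsto (fun t ↦ iteratedDeriv m (fun s ↦ deriv (ξ i) s - (((((Λ i s : lorentzGroup) : E4 ≃L[ℝ] E4) (E4.basisVector 0)) 0)⁻¹ • E4.spatial (((Λ i s : lorentzGroup) : E4 ≃L[ℝ] E4) (E4.basisVector 0)))) t) atTop (𝓝 0)) ∧ (a i ≠ 0 → ∀ m : ℕ, 1 ≤ m → m ≤ 3 → Tendsto (fun t ↦ iteratedDeriv m (fun s ↦ (((Λ i s : lorentzGroup) : E4 ≃L[ℝ] E4) (E4.basisVector 3))) t) atTop (𝓝 0))) →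
    (∀ ρ : ℝ → ℝ, Tendsto ρ atTop atTop → Tendsto (fun t : ℝ ↦ ⨆ x ∈ {x : E4 | x 0 = t ∧ E4.spatialNorm x ≤ κ * t ∧ ρ t ≤ ⨅ i, ‖E4.spatial x - ξ i t‖}, ENNReal.ofReal (1 + √(√((⨅ i, ‖E4.spatial x - ξ i t‖) ^ 7))) * ‖fderiv ℝ (fun y : E4 ↦ Minkowski.bilin + ∑ i, (boostedKerrBilin (Λ i (y 0)) (E4.ofTimeSpace (y 0) (ξ i (y 0))) (M i) (a i) y - Minkowski.bilin)) x (E4.basisVector 0)‖ₑ) atTop (𝓝 0)) →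
    (∀ ρ : ℝ → ℝ, Tendsto ρ atTop atTop → ∀ δ : ℝ, 0 < δ → δ < 1 → ∃ (C T : ℝ), ∀ (t₁ t₂ : ℝ) (c : ℝ → E3) (R : ℝ → ℝ), T ≤ t₁ → t₁ ≤ t₂ → (∀ s ∈ Set.Icc t₁ t₂, ∀ s' ∈ Set.Icc t₁ t₂, ‖c s - c s'‖ ≤ 2 * |s - s'| ∧ |R s - R s'| ≤ 2 * |s - s'|) → (∀ s ∈ Set.Icc t₁ t₂, ρ s ≤ δ * R s ∧ ‖c s‖ + R s ≤ (κ + κ ^ 2) / 2 * s ∧ ∀ j, ‖ξ j s - c s‖ ≤ (1 - δ) * R s ∨ (1 + δ) * R s ≤ ‖ξ j s - c s‖) → ∀ μ : Fin 4, |(LandauLifshitz.quasiLocalMomentum (fun x : E4 ↦ (Minkowski.bilin + ∑ i, (boostedKerrBilin (Λ i (x 0)) (E4.ofTimeSpace (x 0) (ξ i (x 0))) (M i) (a i) x - Minkowski.bilin)) + 𝒟.toSpacetime.deviationExtend (⟨U, fun x ↦ Minkowski.bilin + ∑ i, (boostedKerrBilin (Λ i (x 0)) (E4.ofTimeSpace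 (x 0) (ξ i (x 0))) (M i) (a i) x - Minkowski.bilin), fun x ↦ x 0, E4.spatialNorm⟩ : ModelBackground) Φ x)) t₂ (c t₂) (R t₂) μ - (LandauLifshitz.quasiLocalMomentum (fun x : E4 ↦ (Minkowski.bilin + ∑ i, (boostedKerrBilin (Λ i (x 0)) (E4.ofTimeSpace (x 0) (ξ i (x 0))) (M i) (a i) x - Minkowski.bilin)) + 𝒟.toSpacetime.deviationExtend (⟨U, fun x ↦ Minkowski.bilin + ∑ i, (boostedKerrBilin (Λ i (x 0)) (E4.ofTimeSpace (x 0) (ξ i (x 0))) (M i) (a i) x - Minkowski.bilin), fun x ↦ x 0, E4.spatialNorm⟩ : ModelBackground) Φ x)) t₁ (c t₁) (R t₁) μ| ≤ C * ∫ s in t₁..t₂, (R s ^ (3 / 2 : ℝ))⁻¹) := by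
  intro hWCH X _ _ _ _ _ _ D hD 𝒟 h𝒟 N M a rin Λ ξ γ κ τ₀ U Φ O hL hN hS hQ ρ hρ δ hδ0 hδ1
  classical
  obtain ⟨hsub, hγ, hsmooth, hsep, hκ, hU, hrest⟩ := hL
  obtain ⟨hΦ, -, -, -, hWt, -, -⟩ := hrest
  set G : E4 → E4 →L[ℝ] E4 →L[ℝ] ℝ := fun x ↦ Minkowski.bilin + ∑ i, (boostedKerrBilin (Λ i (x 0)) (E4.ofTimeSpace (x 0) (ξ i (x 0))) (M i) (a i) x - Minkowski.bilin) with hGdef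
  set B : ModelBackground := ⟨U, G, fun x ↦ x 0, E4.spatialNorm⟩ with hBdef
  set lab : E4 → E4 →L[ℝ] E4 →L[ℝ] ℝ := fun x ↦ G x + 𝒟.toSpacetime.deviationExtend B Φ x with hlabdef
  have hrin : ∀ i, 0 ≤ rin i := fun i ↦ (hsub i).1.rMinus_nonneg.trans (hsub i).2.1.le
  have hΛ : ∀ i, ContDiff ℝ ∞ (fun t ↦ ((Λ i t : E4 ≃L[ℝ] E4) : E4 →L[ℝ] E4)) := fun i ↦ (hsmooth i).2
  have hξ : ∀ i, ContDiff ℝ ∞ (ξ i) := fun i ↦ (hsmooth i).1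
  have hRic : ∀ [𝒟.toSpacetime.metric.toPseudoRiemannianMetric.HasLeviCivita],
      𝒟.toSpacetime.metric.toPseudoRiemannianMetric.IsRicciFlat := 𝒟.isRicciFlat
  obtain ⟨hκ0, hκ1, -⟩ := hκ
  obtain ⟨hWopen, hWsmooth, hWsymm, hWric⟩ := ChargeModel.labRegion_props 𝒟.toSpacetime B Φ hΦ hRic
  obtain ⟨ρ', hρ', T', hT'⟩ := WindowPaths.exists_local_lower_threshold hρ
  have hρq : Tendsto (fun s ↦ ρ' s / 2) atTop atTop := hρ'.atTop_div_const (by norm_num)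
  obtain ⟨Tsc, K, hK0, hsc⟩ := ChargeModel.sphereConditions 𝒟.toSpacetime M a rin Λ ξ γ κ τ₀ U Φ hrin hγ hΛ hξ hU
    hΦ hWt hQ (fun s ↦ ρ' s / 2) hρq
  obtain ⟨CW, hCW⟩ := hWCH
  have hspeed : ∀ᶠ t in atTop, ∀ i, ‖deriv (ξ i) t‖ ≤ 2 :=
    eventually_all.2 fun i ↦ eventually_norm_deriv_centre_le_two (Λ i) (ξ i)
      (by simpa only [iteratedDeriv_zero] using (hS i).2.1 0 (Nat.zero_le 2))
  obtain ⟨Tv, hTv⟩ := eventually_atTop.1 hspeed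
  obtain ⟨Tρ, hTρ⟩ := eventually_atTop.1 ((tendsto_atTop.1 hρ) 4)
  have hκκ : 0 < κ - κ ^ 2 := by nlinarith
  set T : ℝ := max Tsc (max (T' + 1) (max Tv (max Tρ (max 1 (max (τ₀ + 1) (1 / (κ - κ ^ 2))))))) with hTdef
  set Kb : ℝ := K * ((δ / 4) ^ (7 / 4 : ℝ))⁻¹ with hKbdef
  have hδ4 : 0 < δ / 4 := by positivity
  have hKb0 : 0 ≤ Kb := mul_nonneg hK0 (inv_nonneg.2 (Real.rpow_nonneg hδ4.le _))
  set CW' : ℝ := max CW 0 with hCW'def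
  have hCW'0 : 0 ≤ CW' := le_max_right _ _
  have hCWle : CW ≤ CW' := le_max_left _ _
  refine ⟨CW' * Kb ^ 2 * (2 * (2 : ℝ) ^ (3 / 2 : ℝ) + 1), T, ?_⟩
  intro t₁ t₂ c R ht₁ ht₁₂ hLip hadm μ
  have hT : ∀ q : ℝ, q = Tsc ∨ q = T' + 1 ∨ q = Tv ∨ q = Tρ ∨ q = 1 ∨ q = τ₀ + 1 ∨ q = 1 / (κ - κ ^ 2) →
      q ≤ t₁ := fun q hq ↦ le_trans (by
        rcases hq with rfl | rfl | rfl | rfl | rfl | rfl | rfl <;> simp [hTdef]) ht₁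
  have hT1 : Tsc ≤ t₁ := hT _ (Or.inl rfl)
  have hT2 : T' + 1 ≤ t₁ := hT _ (Or.inr (Or.inl rfl))
  have hT3 : Tv ≤ t₁ := hT _ (Or.inr (Or.inr (Or.inl rfl)))
  have hT4 : Tρ ≤ t₁ := hT _ (Or.inr (Or.inr (Or.inr (Or.inl rfl))))
  have hT5 : (1 : ℝ) ≤ t₁ := hT _ (Or.inr (Or.inr (Or.inr (Or.inr (Or.inl rfl)))))
  have hT7 : 1 / (κ - κ ^ 2) ≤ t₁ := hT _ (Or.inr (Or.inr (Or.inr (Or.inr (Or.inr (Or.inr rfl))))))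
  rcases eq_or_lt_of_le ht₁₂ with heq | hlt
  · subst heq
    simp
  have hR4 : ∀ s ∈ Icc t₁ t₂, 4 ≤ R s := by
    intro s hs
    obtain ⟨hρs, -, -⟩ := hadm s hs
    have h4 : 4 ≤ ρ s := hTρ s (hT4.trans hs.1)
    have hδR : 4 ≤ δ * R s := h4.trans hρs
    have hR0 : 0 ≤ R s := by
      by_contra hneg
      have : δ * R s ≤ 0 := mul_nonpos_of_nonneg_of_nonpos hδ0.le (not_le.1 hneg).le
      linarith
    nlinarith
  have hRcont : ContinuousOn R (Icc t₁ t₂) :=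
    Metric.continuousOn_iff.2 fun s hs ε hε ↦ ⟨ε / 3, by positivity, fun s' hs' hd ↦ by
      rw [Real.dist_eq] at hd ⊢; linarith [(hLip s' hs' s hs).2]⟩
  set I : ℝ := ∫ s in t₁..t₂, (R s ^ (3 / 2 : ℝ))⁻¹ with hIdef
  have hIcont : ContinuousOn (fun s ↦ (R s ^ (3 / 2 : ℝ))⁻¹) (Icc t₁ t₂) := by
    refine ContinuousOn.inv₀ (hRcont.rpow_const fun s hs ↦ Or.inr (by norm_num)) fun s hs ↦ ?_
    exact (Real.rpow_pos_of_pos (by linarith [hR4 s hs]) _).ne'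
  have hIint : IntervalIntegrable (fun s ↦ (R s ^ (3 / 2 : ℝ))⁻¹) volume t₁ t₂ :=
    (hIcont.mono (by rw [uIcc_of_le ht₁₂])).intervalIntegrable
  have hIpos : 0 < I := intervalIntegral.intervalIntegral_pos_of_pos_on hIint
    (fun s hs ↦ inv_pos.2 (Real.rpow_pos_of_pos (by linarith [hR4 s (Ioo_subset_Icc_self hs)]) _)) hlt
  set η : ℝ := min (1 / 12) I with hηdef
  have hη0 : 0 < η := lt_min (by norm_num) hIpos
  have hη12 : η ≤ 1 / 12 := min_le_left _ _
  have hηI : η ≤ I := min_le_right _ _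
  obtain ⟨ch, hchC1, hchd, hch0, hch1, hchnear⟩ := WindowPaths.exists_contDiff_shadow_of_lipschitzOn (F := E3)
    (c := c) ht₁₂ (by norm_num : (0 : ℝ) ≤ 2) (fun s hs s' hs' ↦ (hLip s hs s' hs').1) hη0
  obtain ⟨Rh, hRhC1, hRhd, hRh0, hRh1, hRhnear⟩ := WindowPaths.exists_contDiff_shadow_of_lipschitzOn (F := ℝ)
    (c := R) ht₁₂ (by norm_num : (0 : ℝ) ≤ 2)
    (fun s hs s' hs' ↦ by rw [Real.norm_eq_abs]; exact (hLip s hs s' hs').2) hη0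
  have hRhnear' : ∀ s, |Rh s - R (max t₁ (min s t₂))| ≤ 2 * η := fun s ↦ by
    have := hRhnear s
    rwa [Real.norm_eq_abs] at this
  have hmove : ∀ (j : Fin N) (s sb : ℝ), t₁ ≤ sb → sb ≤ s → ‖ξ j s - ξ j sb‖ ≤ 2 * (s - sb) := by
    intro j s sb h1 h2
    have hdiff : ∀ x ∈ Icc sb s, DifferentiableAt ℝ (ξ j) x := fun x _ ↦
      ((hξ j).differentiable (by simp)).differentiableAt
    have hbd : ∀ x ∈ Icc sb s, ‖deriv (ξ j) x‖ ≤ 2 := fun x hx ↦ hTv x (hT3.trans (h1.trans hx.1)) j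
    have := (convex_Icc sb s).norm_image_sub_le_of_norm_deriv_le hdiff hbd
      (left_mem_Icc.2 h2) (right_mem_Icc.2 h2)
    rwa [Real.norm_eq_abs, abs_of_nonneg (sub_nonneg.2 h2)] at this
  have hpoint : ∀ (s sb : ℝ) (y : E3) (Rr : ℝ), sb ∈ Icc t₁ t₂ → sb ≤ s → s - sb ≤ η →
      (∀ j, δ * R sb - 4 * η ≤ ‖y - ξ j sb‖) → ‖y‖ ≤ ‖c sb‖ + R sb + 4 * η → 0 < Rr → Rr ≤ 2 * R sb →
      (E4.ofTimeSpace s y ∈ {x : E4 | x ∈ (B.domain : Set E4) ∧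
          ‖(B.bilin x + 𝒟.toSpacetime.deviationExtend B Φ x) - Minkowski.bilin‖ < 1} ∧
        ‖lab (E4.ofTimeSpace s y) - Minkowski.bilin‖ ≤ 1 / 2 ∧
        ∀ v : E4, ‖fderiv ℝ lab (E4.ofTimeSpace s y) v‖ ≤ Kb * (Rr ^ (7 / 4 : ℝ))⁻¹ * ‖v‖) := by
    intro s sb y Rr hsb hsbs hssb hclear hyn hRr0 hRr
    have hs1 : t₁ ≤ s := hsb.1.trans hsbs
    have hR4' : 4 ≤ R sb := hR4 sb hsb
    obtain ⟨hρsb, hcone, -⟩ := hadm sb hsb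
    have hρ4 : 4 ≤ ρ sb := hTρ sb (hT4.trans hsb.1)
    have hδR : 4 ≤ δ * R sb := hρ4.trans hρsb
    have hclear' : ∀ j, δ * R sb / 2 ≤ ‖y - ξ j s‖ := by
      intro j
      have hm := hmove j s sb hsb.1 hsbs
      have h1 : ‖y - ξ j sb‖ ≤ ‖y - ξ j s‖ + ‖ξ j s - ξ j sb‖ := norm_sub_le_norm_sub_add_norm_sub _ _ _
      have h2 := hclear j
      linarith
    haveI : Nonempty (Fin N) := ⟨⟨0, hN⟩⟩
    have hdlow : δ * R sb / 2 ≤ ⨅ j, ‖y - ξ j s‖ := le_ciInf hclear'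
    have hρq_le : ρ' s / 2 ≤ ⨅ j, ‖y - ξ j s‖ := by
      have h1 : ρ' s ≤ ρ sb := hT' s (by linarith) sb (by
        rw [abs_le]; constructor <;> linarith)
      linarith
    have hycone : ‖y‖ ≤ κ * s := by
      have h1 : (κ + κ ^ 2) / 2 * sb ≤ (κ + κ ^ 2) / 2 * s :=
        mul_le_mul_of_nonneg_left hsbs (by positivity)
      have h2 : 4 * η ≤ (κ - κ ^ 2) / 2 * s := by
        have h3 : 1 ≤ (κ - κ ^ 2) * s := by
          have := (div_le_iff₀ hκκ).1 (hT7.trans hs1)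
          linarith
        linarith
      nlinarith
    obtain ⟨hW1, hη2, hD⟩ := hsc s y (hT1.trans hs1) hycone hρq_le
    refine ⟨hW1, hη2, fun v ↦ (hD v).trans ?_⟩
    have hdpos : 0 < ⨅ j, ‖y - ξ j s‖ := lt_of_lt_of_le (by positivity) hdlow
    have hle : δ / 4 * Rr ≤ ⨅ j, ‖y - ξ j s‖ := by
      have : δ / 4 * Rr ≤ δ * R sb / 2 := by nlinarith
      exact this.trans hdlow
    have hpow : (δ / 4 * Rr) ^ (7 / 4 : ℝ) ≤ (⨅ j, ‖y - ξ j s‖) ^ (7 / 4 : ℝ) :=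
      Real.rpow_le_rpow (by positivity) hle (by norm_num)
    have hinv : ((⨅ j, ‖y - ξ j s‖) ^ (7 / 4 : ℝ))⁻¹ ≤ ((δ / 4 * Rr) ^ (7 / 4 : ℝ))⁻¹ :=
      inv_anti₀ (Real.rpow_pos_of_pos (by positivity) _) hpow
    have hsplit : ((δ / 4 * Rr) ^ (7 / 4 : ℝ))⁻¹ = ((δ / 4) ^ (7 / 4 : ℝ))⁻¹ * (Rr ^ (7 / 4 : ℝ))⁻¹ := by
      rw [Real.mul_rpow hδ4.le hRr0.le, mul_inv]
    calc K * ((⨅ j, ‖y - ξ j s‖) ^ (7 / 4 : ℝ))⁻¹ * ‖v‖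
        ≤ K * ((δ / 4 * Rr) ^ (7 / 4 : ℝ))⁻¹ * ‖v‖ := by gcongr
      _ = Kb * (Rr ^ (7 / 4 : ℝ))⁻¹ * ‖v‖ := by rw [hsplit, hKbdef]; ring
  have hclamp : ∀ s ∈ Icc t₁ (t₂ + η), max t₁ (min s t₂) ∈ Icc t₁ t₂ ∧ max t₁ (min s t₂) ≤ s ∧
      s - max t₁ (min s t₂) ≤ η := by
    intro s hs
    refine ⟨⟨le_max_left _ _, max_le ht₁₂ (min_le_right _ _)⟩, ?_⟩
    rcases le_total s t₂ with h | h
    · rw [min_eq_left h, max_eq_right hs.1, sub_self]; exact ⟨le_rfl, hη0.le⟩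
    · rw [min_eq_right h, max_eq_right ht₁₂]; exact ⟨h, by linarith [hs.2]⟩
  have hpath : ∀ s ∈ Icc t₁ (t₂ + η), ∀ y ∈ Metric.sphere (ch s) (Rh s),
      E4.ofTimeSpace s y ∈ {x : E4 | x ∈ (B.domain : Set E4) ∧
          ‖(B.bilin x + 𝒟.toSpacetime.deviationExtend B Φ x) - Minkowski.bilin‖ < 1} ∧
        ‖lab (E4.ofTimeSpace s y) - Minkowski.bilin‖ ≤ 1 / 2 ∧
        ∀ v : E4, ‖fderiv ℝ lab (E4.ofTimeSpace s y) v‖ ≤ Kb * (Rh s ^ (7 / 4 : ℝ))⁻¹ * ‖v‖ := by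
    intro s hs y hy
    obtain ⟨hsb, hsbs, hssb⟩ := hclamp s hs
    set sb := max t₁ (min s t₂) with hsbdef
    have hR4' : 4 ≤ R sb := hR4 sb hsb
    have hRn : |Rh s - R sb| ≤ 2 * η := hRhnear' s
    have hcn : ‖ch s - c sb‖ ≤ 2 * η := hchnear s
    rw [mem_sphere_iff_norm] at hy
    have hyc1 : R sb - 4 * η ≤ ‖y - c sb‖ := by
      have h1 : ‖y - ch s‖ ≤ ‖y - c sb‖ + ‖c sb - ch s‖ := norm_sub_le_norm_sub_add_norm_sub _ _ _
      rw [norm_sub_rev (c sb)] at h1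
      have h2 := (abs_le.1 hRn).1
      linarith
    have hyc2 : ‖y - c sb‖ ≤ R sb + 4 * η := by
      have h1 : ‖y - c sb‖ ≤ ‖y - ch s‖ + ‖ch s - c sb‖ := norm_sub_le_norm_sub_add_norm_sub _ _ _
      have h2 := (abs_le.1 hRn).2
      linarith
    obtain ⟨-, -, hclr⟩ := hadm sb hsb
    have hclear : ∀ j, δ * R sb - 4 * η ≤ ‖y - ξ j sb‖ := by
      intro j
      rcases hclr j with h | h
      · have h1 : ‖y - c sb‖ ≤ ‖y - ξ j sb‖ + ‖ξ j sb - c sb‖ := norm_sub_le_norm_sub_add_norm_sub _ _ _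
        nlinarith
      · have h1 : ‖ξ j sb - c sb‖ ≤ ‖ξ j sb - y‖ + ‖y - c sb‖ := norm_sub_le_norm_sub_add_norm_sub _ _ _
        rw [norm_sub_rev (ξ j sb) y] at h1
        nlinarith
    have hyn : ‖y‖ ≤ ‖c sb‖ + R sb + 4 * η := by
      have h1 : ‖y‖ ≤ ‖y - c sb‖ + ‖c sb‖ := norm_le_norm_sub_add y (c sb)
      linarith
    have hRr0 : 0 < Rh s := by
      have h2 := (abs_le.1 hRn).1
      linarith
    have hRr : Rh s ≤ 2 * R sb := by
      have h2 := (abs_le.1 hRn).2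
      linarith
    exact hpoint s sb y (Rh s) hsb hsbs hssb hclear hyn hRr0 hRr
  have hstat : ∀ s ∈ Icc t₂ (t₂ + η), ∀ y ∈ Metric.sphere (c t₂) (R t₂),
      E4.ofTimeSpace s y ∈ {x : E4 | x ∈ (B.domain : Set E4) ∧
          ‖(B.bilin x + 𝒟.toSpacetime.deviationExtend B Φ x) - Minkowski.bilin‖ < 1} ∧
        ‖lab (E4.ofTimeSpace s y) - Minkowski.bilin‖ ≤ 1 / 2 ∧
        ∀ v : E4, ‖fderiv ℝ lab (E4.ofTimeSpace s y) v‖ ≤ Kb * (R t₂ ^ (7 / 4 : ℝ))⁻¹ * ‖v‖ := by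
    intro s hs y hy
    have ht₂ : t₂ ∈ Icc t₁ t₂ := right_mem_Icc.2 ht₁₂
    have hR4' : 4 ≤ R t₂ := hR4 t₂ ht₂
    rw [mem_sphere_iff_norm] at hy
    obtain ⟨-, -, hclr⟩ := hadm t₂ ht₂
    have hclear : ∀ j, δ * R t₂ - 4 * η ≤ ‖y - ξ j t₂‖ := fun j ↦ by
      have := WindowBounds.clearance_of_window hy (hclr j)
      linarith
    have hyn : ‖y‖ ≤ ‖c t₂‖ + R t₂ + 4 * η := by
      have h1 : ‖y‖ ≤ ‖y - c t₂‖ + ‖c t₂‖ := norm_le_norm_sub_add y (c t₂)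
      linarith
    exact hpoint s t₂ y (R t₂) ht₂ hs.1 (by linarith [hs.2]) hclear hyn (by linarith) (by linarith)
  have hRhB : ∀ s ∈ Icc t₁ (t₂ + η), 1 ≤ Rh s ∧ R (max t₁ (min s t₂)) / 2 ≤ Rh s ∧ 0 < Rh s := by
    intro s hs
    obtain ⟨hsb, -, -⟩ := hclamp s hs
    have h4 := hR4 _ hsb
    have hn := (abs_le.1 (hRhnear' s)).1
    exact ⟨by linarith, by linarith, by linarith⟩
  have ht₂η : t₁ ≤ t₂ + η := by linarith
  have ht₂ : t₂ ∈ Icc t₁ t₂ := right_mem_Icc.2 ht₁₂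
  have hRt₂ : 4 ≤ R t₂ := hR4 t₂ ht₂
  set b₁ : ℝ → ℝ := fun s ↦ Kb * (Rh s ^ (7 / 4 : ℝ))⁻¹ with hb₁def
  set b₂ : ℝ → ℝ := fun _ ↦ Kb * (R t₂ ^ (7 / 4 : ℝ))⁻¹ with hb₂def
  have hRhpow_cont : ContinuousOn (fun s ↦ Rh s ^ (7 / 4 : ℝ)) (Icc t₁ (t₂ + η)) :=
    hRhC1.continuous.continuousOn.rpow_const fun s _ ↦ Or.inr (by norm_num)
  have hb₁cont : ContinuousOn b₁ (Icc t₁ (t₂ + η)) :=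
    continuousOn_const.mul (hRhpow_cont.inv₀ fun s hs ↦ (Real.rpow_pos_of_pos (hRhB s hs).2.2 _).ne')
  have h1 := hCW lab {x : E4 | x ∈ (B.domain : Set E4) ∧
      ‖(B.bilin x + 𝒟.toSpacetime.deviationExtend B Φ x) - Minkowski.bilin‖ < 1} ch Rh b₁ t₁ (t₂ + η)
    hWopen hWsmooth hWsymm hWric (by linarith) ht₂η hchC1 hRhC1 hb₁cont
    (fun t ht ↦ ⟨hchd t, by rw [← Real.norm_eq_abs]; exact hRhd t, (hRhB t ht).1⟩) hpath μ
  have h2 := hCW lab {x : E4 | x ∈ (B.domain : Set E4) ∧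
      ‖(B.bilin x + 𝒟.toSpacetime.deviationExtend B Φ x) - Minkowski.bilin‖ < 1}
    (fun _ ↦ c t₂) (fun _ ↦ R t₂) b₂ t₂ (t₂ + η)
    hWopen hWsmooth hWsymm hWric (by linarith) (by linarith) contDiff_const contDiff_const continuousOn_const
    (fun t _ ↦ ⟨by simp, by simp, by linarith⟩) hstat μ
  rw [hch0, hRh0, hch1, hRh1] at h1
  have hpow32 := fun (r : ℝ) (hr : 0 < r) ↦ windowIntegrand_eq Kb r hr
  have hmono := fun (r r' : ℝ) (hr' : 0 < r') (hle : r' / 2 ≤ r) ↦ rpow_threeHalves_inv_le r r' hr' hle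
  have hinv_le_one : ∀ r : ℝ, 1 ≤ r → (r ^ (3 / 2 : ℝ))⁻¹ ≤ 1 := fun r hr ↦
    inv_le_one_of_one_le₀ (Real.one_le_rpow hr (by norm_num))
  have h232 : (1 : ℝ) ≤ (2 : ℝ) ^ (3 / 2 : ℝ) := Real.one_le_rpow (by norm_num) (by norm_num)
  have hint₁ : ∀ s ∈ Icc t₁ (t₂ + η), Rh s ^ 2 * b₁ s ^ 2 = Kb ^ 2 * (Rh s ^ (3 / 2 : ℝ))⁻¹ :=
    fun s hs ↦ hpow32 (Rh s) (hRhB s hs).2.2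
  have hcont₁ : ContinuousOn (fun s ↦ Rh s ^ 2 * b₁ s ^ 2) (Icc t₁ (t₂ + η)) :=
    ((hRhC1.continuous.continuousOn.pow 2).mul (hb₁cont.pow 2))
  have hii₁ : ∀ a b : ℝ, Icc a b ⊆ Icc t₁ (t₂ + η) → a ≤ b →
      IntervalIntegrable (fun s ↦ Rh s ^ 2 * b₁ s ^ 2) volume a b := fun a b hsub hab ↦
    ((hcont₁.mono hsub).mono (by rw [uIcc_of_le hab])).intervalIntegrable
  have hJ₁a : ∫ s in t₁..t₂, Rh s ^ 2 * b₁ s ^ 2 ≤ Kb ^ 2 * (2 : ℝ) ^ (3 / 2 : ℝ) * I := by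
    have hle : ∀ s ∈ Icc t₁ t₂, Rh s ^ 2 * b₁ s ^ 2 ≤ Kb ^ 2 * (2 : ℝ) ^ (3 / 2 : ℝ) * (R s ^ (3 / 2 : ℝ))⁻¹ := by
      intro s hs
      have hs' : s ∈ Icc t₁ (t₂ + η) := ⟨hs.1, hs.2.trans (by linarith)⟩
      rw [hint₁ s hs']
      have hcl : max t₁ (min s t₂) = s := by rw [min_eq_left hs.2, max_eq_right hs.1]
      have hm := hmono (Rh s) (R s) (by linarith [hR4 s hs]) (by
        have h := (hRhB s hs').2.1
        rwa [hcl] at h)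
      calc Kb ^ 2 * (Rh s ^ (3 / 2 : ℝ))⁻¹ ≤ Kb ^ 2 * ((2 : ℝ) ^ (3 / 2 : ℝ) * (R s ^ (3 / 2 : ℝ))⁻¹) :=
            mul_le_mul_of_nonneg_left hm (sq_nonneg _)
        _ = Kb ^ 2 * (2 : ℝ) ^ (3 / 2 : ℝ) * (R s ^ (3 / 2 : ℝ))⁻¹ := by ring
    calc ∫ s in t₁..t₂, Rh s ^ 2 * b₁ s ^ 2
        ≤ ∫ s in t₁..t₂, Kb ^ 2 * (2 : ℝ) ^ (3 / 2 : ℝ) * (R s ^ (3 / 2 : ℝ))⁻¹ :=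
          intervalIntegral.integral_mono_on ht₁₂
            (hii₁ t₁ t₂ (Icc_subset_Icc le_rfl (by linarith)) ht₁₂) (hIint.const_mul _) hle
      _ = Kb ^ 2 * (2 : ℝ) ^ (3 / 2 : ℝ) * I := by rw [intervalIntegral.integral_const_mul]
  have hJ₁b : ∫ s in t₂..(t₂ + η), Rh s ^ 2 * b₁ s ^ 2 ≤ Kb ^ 2 * η := by
    have hle : ∀ s ∈ Icc t₂ (t₂ + η), Rh s ^ 2 * b₁ s ^ 2 ≤ Kb ^ 2 := by
      intro s hs
      have hs' : s ∈ Icc t₁ (t₂ + η) := ⟨ht₁₂.trans hs.1, hs.2⟩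
      rw [hint₁ s hs']
      exact mul_le_of_le_one_right (sq_nonneg Kb) (hinv_le_one (Rh s) (hRhB s hs').1)
    calc ∫ s in t₂..(t₂ + η), Rh s ^ 2 * b₁ s ^ 2 ≤ ∫ _ in t₂..(t₂ + η), Kb ^ 2 :=
          intervalIntegral.integral_mono_on (by linarith)
            (hii₁ t₂ (t₂ + η) (Icc_subset_Icc ht₁₂ le_rfl) (by linarith)) intervalIntegrable_const hle
      _ = Kb ^ 2 * η := by rw [intervalIntegral.integral_const, smul_eq_mul]; ring
  have hJ₁ : ∫ s in t₁..(t₂ + η), Rh s ^ 2 * b₁ s ^ 2 ≤ Kb ^ 2 * (2 : ℝ) ^ (3 / 2 : ℝ) * I + Kb ^ 2 * η := by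
    rw [← intervalIntegral.integral_add_adjacent_intervals
      (hii₁ t₁ t₂ (Icc_subset_Icc le_rfl (by linarith)) ht₁₂)
      (hii₁ t₂ (t₂ + η) (Icc_subset_Icc ht₁₂ le_rfl) (by linarith))]
    exact add_le_add hJ₁a hJ₁b
  have hJ₂ : ∫ s in t₂..(t₂ + η), R t₂ ^ 2 * b₂ s ^ 2 ≤ Kb ^ 2 * η := by
    have hconst : ∫ s in t₂..(t₂ + η), R t₂ ^ 2 * b₂ s ^ 2 = η * (Kb ^ 2 * (R t₂ ^ (3 / 2 : ℝ))⁻¹) := by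
      simp only [hb₂def]
      rw [intervalIntegral.integral_const, smul_eq_mul, hpow32 (R t₂) (by linarith)]
      ring
    rw [hconst]
    have hq := hinv_le_one (R t₂) (by linarith)
    have hq0 : 0 ≤ η * Kb ^ 2 := mul_nonneg hη0.le (sq_nonneg Kb)
    calc η * (Kb ^ 2 * (R t₂ ^ (3 / 2 : ℝ))⁻¹) = (η * Kb ^ 2) * (R t₂ ^ (3 / 2 : ℝ))⁻¹ := by ring
      _ ≤ (η * Kb ^ 2) * 1 := mul_le_mul_of_nonneg_left hq hq0
      _ = Kb ^ 2 * η := by ring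
  have hJ₁0 : 0 ≤ ∫ s in t₁..(t₂ + η), Rh s ^ 2 * b₁ s ^ 2 :=
    intervalIntegral.integral_nonneg ht₂η fun s _ ↦ by positivity
  have hJ₂0 : 0 ≤ ∫ s in t₂..(t₂ + η), R t₂ ^ 2 * b₂ s ^ 2 :=
    intervalIntegral.integral_nonneg (by linarith) fun s _ ↦ by positivity
  change |LandauLifshitz.quasiLocalMomentum lab t₂ (c t₂) (R t₂) μ -
      LandauLifshitz.quasiLocalMomentum lab t₁ (c t₁) (R t₁) μ| ≤ CW' * Kb ^ 2 * (2 * (2 : ℝ) ^ (3 / 2 : ℝ) + 1) * I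
  have htri : |LandauLifshitz.quasiLocalMomentum lab t₂ (c t₂) (R t₂) μ -
      LandauLifshitz.quasiLocalMomentum lab t₁ (c t₁) (R t₁) μ| ≤
      |LandauLifshitz.quasiLocalMomentum lab (t₂ + η) (c t₂) (R t₂) μ -
        LandauLifshitz.quasiLocalMomentum lab t₁ (c t₁) (R t₁) μ| +
      |LandauLifshitz.quasiLocalMomentum lab (t₂ + η) (c t₂) (R t₂) μ -
        LandauLifshitz.quasiLocalMomentum lab t₂ (c t₂) (R t₂) μ| := by
    have := abs_sub_le (LandauLifshitz.quasiLocalMomentum lab t₂ (c t₂) (R t₂) μ)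
      (LandauLifshitz.quasiLocalMomentum lab (t₂ + η) (c t₂) (R t₂) μ)
      (LandauLifshitz.quasiLocalMomentum lab t₁ (c t₁) (R t₁) μ)
    have e' : |LandauLifshitz.quasiLocalMomentum lab t₂ (c t₂) (R t₂) μ -
        LandauLifshitz.quasiLocalMomentum lab (t₂ + η) (c t₂) (R t₂) μ| =
        |LandauLifshitz.quasiLocalMomentum lab (t₂ + η) (c t₂) (R t₂) μ -
          LandauLifshitz.quasiLocalMomentum lab t₂ (c t₂) (R t₂) μ| := abs_sub_comm _ _
    linarith
  have hK2 : 0 ≤ CW' * Kb ^ 2 := by positivity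
  calc |LandauLifshitz.quasiLocalMomentum lab t₂ (c t₂) (R t₂) μ -
        LandauLifshitz.quasiLocalMomentum lab t₁ (c t₁) (R t₁) μ|
      ≤ CW * (∫ s in t₁..(t₂ + η), Rh s ^ 2 * b₁ s ^ 2) + CW * (∫ s in t₂..(t₂ + η), R t₂ ^ 2 * b₂ s ^ 2) :=
        htri.trans (add_le_add h1 h2)
    _ ≤ CW' * (∫ s in t₁..(t₂ + η), Rh s ^ 2 * b₁ s ^ 2) + CW' * (∫ s in t₂..(t₂ + η), R t₂ ^ 2 * b₂ s ^ 2) :=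
        add_le_add (mul_le_mul_of_nonneg_right hCWle hJ₁0) (mul_le_mul_of_nonneg_right hCWle hJ₂0)
    _ ≤ CW' * (Kb ^ 2 * (2 : ℝ) ^ (3 / 2 : ℝ) * I + Kb ^ 2 * η) + CW' * (Kb ^ 2 * η) :=
        add_le_add (mul_le_mul_of_nonneg_left hJ₁ hCW'0) (mul_le_mul_of_nonneg_left hJ₂ hCW'0)
    _ = CW' * Kb ^ 2 * ((2 : ℝ) ^ (3 / 2 : ℝ) * I + 2 * η) := by ring
    _ ≤ CW' * Kb ^ 2 * ((2 * (2 : ℝ) ^ (3 / 2 : ℝ) + 1) * I) := by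
        refine mul_le_mul_of_nonneg_left ?_ hK2
        nlinarith [hηI, hIpos.le, h232]
    _ = CW' * Kb ^ 2 * (2 * (2 : ℝ) ^ (3 / 2 : ℝ) + 1) * I := by ring

end SublinearIsFree.ChargeModel

/-- Registered sub-goal form (stub `stub_chargeModel_holeSpeed` of the crux item) of
`SublinearIsFree.ChargeModel.eventually_norm_deriv_centre_le_two` (carrier of this file, whose main content
`windowLaw_of_windowCharges` has a statement exceeding the stub-signature size limit). [folklore] -/
theorem stub_chargeModel_holeSpeed : open Literature.Geometry.Lorentzian Filter in ∀ (Λ : ℝ → lorentzGroup) (ξ : ℝ → E3), Tendsto (fun t ↦ deriv ξ t - ((((Λ t : lorentzGroup) : E4 ≃L[ℝ] E4) (E4.basisVector 0)) 0)⁻¹ • E4.spatial (((Λ t : lorentzGroup) : E4 ≃L[ℝ] E4) (E4.basisVector 0))) atTop (nhds 0) → ∀ᶠ t in atTop, ‖deriv ξ t‖ ≤ 2 :=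
  SublinearIsFree.ChargeModel.eventually_norm_deriv_centre_le_two

end Summit.FinalStateConjecture.FinalStateConjecture.Theorems

end
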